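import Summits.KontsevichZagierPeriods.Zeta5Search.TwoTaleOmega.StepARKit
import Summits.KontsevichZagierPeriods.Zeta5Search.TwoTaleOmega.CertAtomsAR

/-!
# (bmiss)@Ω — the recurrence in direction `a`, SECOND TALE, for `g ≥ b + 4` (cell `pub-zeta5`, cert-1 gen 4)

HONEST FRAMING: systematic search; recurrence certificates; no irrationality claim unless certified. Pure finite algebra
over `ℚ`; no named fact, no `sorry`.

Blueprint `families/tele/RECURRENCE.md` §13.10–13.12, direction `δ = a`, side `R` (lattice variable `u = 2t`), on the template
of `StepBR/StepER/StepGR`. INPUT: cert-2's `telescope_a_R` (`Cert_R = (t+e+f−1)(t+g−1)(2t+a+2)(2t+a+3)(t+a−b+3)·x_R(t) /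
((2t+a+1)(2t+a+2)(2t+a+3)(t+a−b+1)(t+a−b+2)(t+a−b+3)(f−a+e−1)(f−a+e−2)(f−a+e−3))`, `x_R` cubic, `t`-free factors `(f−a+e−j)`;
atoms opaque, `CertAtomsAR`). Along `δ_a`: `κ(p)= (−1)^k κ(p+kδ)·∏_{j<k}(f−a−k+e+j)`; the numerator blocks `(2t+a+1…)` and
`[a−b+1,f)` and the denominator block `[a,g)` shrink from below, `(…2t+g−b+a−1)` grows:
`F_R(p+kδ;u)·block_u(a+1,a+1+k)·block_t(a−b+1,a−b+1+k)·∏_{j<k}(f−a−k+e+j) = (−1)^k block_u(g−b+a,g−b+a+k)·block_t(a,a+k)·F_R(p;u)`.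
At the base point of an `a`-step (`p+3δ ∈ Ω`) the certificate denominators cancel into the data and
`GfAR = ofFrac (2·[e,e+f−1) ∪ 2·[a,g−1)) twoRange (C(κ·2^{g−b+1}/((f−a+e−1)(f−a+e−2)(f−a+e−3)))·block(a+2,g−b+a)·eblock(a−b+3,f)·x_R(u/2))`.
COMMON NODE `M* = −(a+3)` (NOT `−a`): its legitimacy needs the zero `(u+a+3)` of `block(a+2,g−b+a)`, i.e. **`g ≥ b+4`** — the
extra hypothesis of `recR_a` (for `g = b+3` the termwise legitimacy genuinely fails at 49/105 sampled base points,
`HOME/cert-1/g4/tools/legit_a2.py`). OUTPUT `recR_a`.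
-/

noncomputable section

open Finset Polynomial
open Literature.NumberTheory.Irrationality.Zudilin2014
open Summit.KontsevichZagierPeriods.Zeta5Search.FormalBarnes
open Summit.KontsevichZagierPeriods.Zeta5Search.Certificates.TwoTaleTelescope

namespace Summit.KontsevichZagierPeriods.Zeta5Search.TwoTaleOmega

namespace Pt

/-! ### The telescoped function `G = Cert_R · F_R(p;·)` as closed-form data -/

variable (p : Pt)

/-- The rational certificate `Cert_R(p; u/2)` of direction `a` in the lattice variable (`x_R` as `xPolyARu`). -/
def certAR (u : ℚ) : ℚ :=
  (u / 2 + (p.e + p.f - 1 : ℤ)) * (u / 2 + (p.g - 1 : ℤ)) * (u + p.a + 2) * (u + p.a + 3) * (u / 2 + (p.a - p.b + 3 : ℤ))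
    * (xPolyARu (p.a : ℚ) p.b p.e p.f p.g).eval u
    / ((u + p.a + 1) * (u / 2 + (p.a - p.b + 1 : ℤ)) * ((p.f : ℚ) - p.a + p.e - 1) * (u + p.a + 2) * (u / 2 + (p.a - p.b + 2 : ℤ))
      * ((p.f : ℚ) - p.a + p.e - 2) * (u + p.a + 3) * (u / 2 + (p.a - p.b + 3 : ℤ)) * ((p.f : ℚ) - p.a + p.e - 3))

/-- Numerator of `G_{a,R}` on the even lattice (certificate denominators cancelled into the data; valid at `a`-step base points). -/
def NGAR : ℚ[X] :=
  C (p.kap * 2 ^ (p.g - p.b + 1).toNat / (((p.f : ℚ) - p.a + p.e - 1) * ((p.f : ℚ) - p.a + p.e - 2) * ((p.f : ℚ) - p.a + p.e - 3)))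
    * (block (p.a + 2) (p.g - p.b + p.a) * eblock (p.a - p.b + 3) p.f) * xPolyARu (p.a : ℚ) p.b p.e p.f p.g

/-- **The telescoped data** `G_{a,R}(p)` (poles `2·[e,e+f−1) ∪ 2·[a,g−1)` = `StepBR.AG ∪ StepBR.BG`). -/
def GfAR : PF := PF.ofFrac (p.AG ∪ p.BG) (twoRange p.AG p.BG) p.NGAR

variable {p}

/-- The polynomial part of `G_{a,R}` is constant (at `a`-step base points). -/
theorem natDegree_GfAR_le (h : p.Omega) (h3 : (p.addA 3).Omega) : p.GfAR.poly.natDegree ≤ 0 := by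
  obtain ⟨b1, b2, b3, b4⟩ := base_ineq_addA p h3
  obtain ⟨o1, o2, o3, o4, o5, o6, o7, o8, o9⟩ := h
  unfold GfAR
  rw [PF.natDegree_ofFrac, sum_twoRange]
  have hN : p.NGAR.natDegree ≤ (p.g - p.b + p.a - (p.a + 2)).toNat + (p.f - (p.a - p.b + 3)).toNat + 3 := by
    unfold NGAR
    refine (natDegree_mul_le).trans (Nat.add_le_add ((natDegree_C_mul_le _ _).trans ((natDegree_mul_le).trans ?_))
      (natDegree_xPolyARu_le _ _ _ _ _))
    rw [natDegree_block, natDegree_eblock]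
  unfold AG BG
  rw [card_image_of_injective _ fun x y h => mul_left_cancel₀ two_ne_zero h,
    card_image_of_injective _ fun x y h => mul_left_cancel₀ two_ne_zero h, Int.card_Ico, Int.card_Ico]
  omega

/-- The `t`-free certificate denominators do not vanish at an `a`-step base point. -/
theorem ef_ne_zero (h3 : (p.addA 3).Omega) :
    ((p.f : ℚ) - p.a + p.e - 1) ≠ 0 ∧ ((p.f : ℚ) - p.a + p.e - 2) ≠ 0 ∧ ((p.f : ℚ) - p.a + p.e - 3) ≠ 0 := by
  have := h3.twoE; have := h3.twoF; have := h3.e_le; have := h3.f_le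
  simp only [addA_a, addA_e, addA_f] at *
  refine ⟨?_, ?_, ?_⟩
  · have : ((p.f : ℚ) - p.a + p.e - 1) = ((p.f - p.a + p.e - 1 : ℤ) : ℚ) := by push_cast; ring
    rw [this]; exact_mod_cast (by omega : (p.f - p.a + p.e - 1 : ℤ) ≠ 0)
  · have : ((p.f : ℚ) - p.a + p.e - 2) = ((p.f - p.a + p.e - 2 : ℤ) : ℚ) := by push_cast; ring
    rw [this]; exact_mod_cast (by omega : (p.f - p.a + p.e - 2 : ℤ) ≠ 0)
  · have : ((p.f : ℚ) - p.a + p.e - 3) = ((p.f - p.a + p.e - 3 : ℤ) : ℚ) := by push_cast; ring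
    rw [this]; exact_mod_cast (by omega : (p.f - p.a + p.e - 3 : ℤ) ≠ 0)

/-- **`G = Cert_R · F_R`**: off the exceptional lattice, `G_{a,R}(u) = Cert_R(u/2)·vR(p)(u)` (at `a`-step base points). -/
theorem GfAR_eq_cert (h : p.Omega) (h3 : (p.addA 3).Omega) {u : ℚ} (hu' : ∀ K ∈ Icc (-(4 * p.g)) (4 * p.g), u + K ≠ 0) :
    p.GfAR.eval u = p.certAR u * p.vR.eval u := by
  have hp := h.pos
  obtain ⟨b1, b2, b3, b4⟩ := base_ineq_addA p h3
  obtain ⟨ef1, ef2, ef3⟩ := ef_ne_zero h3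
  obtain ⟨o1, o2, o3, o4, o5, o6, o7, o8, o9⟩ := id h
  have hu : ∀ K ∈ Icc 1 (4 * p.g), u + K ≠ 0 := fun K hK => hu' K (by rw [mem_Icc] at hK ⊢; omega)
  have nz' : ∀ K : ℤ, -(4 * p.g) ≤ K → K ≤ 4 * p.g → u + K ≠ 0 := fun K h1 h2 => hu' K (mem_Icc.2 ⟨h1, h2⟩)
  have huG : ∀ K ∈ p.AG ∪ p.BG, u + K ≠ 0 := fun K hK => hu K (mem_Icc.2 (mem_Icc_of_mem h (Or.inl hK)))
  have huR : ∀ K ∈ p.AR ∪ p.BR, u + K ≠ 0 := fun K hK => hu K (mem_Icc.2 (mem_Icc_of_mem h (Or.inr hK)))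
  rw [vR_eq_ofFrac h]
  unfold GfAR
  rw [PF.eval_ofFrac _ _ _ (fun _ hk => twoRange_mem hk) huG, PF.eval_ofFrac _ _ _ (fun _ hk => twoRange_mem hk) huR,
    denom_twoRange, denom_twoRange]
  unfold AG BG AR BR NGAR NR certAR
  rw [← eblock_eq_prod_image, ← eblock_eq_prod_image, ← eblock_eq_prod_image, ← eblock_eq_prod_image]
  rw [block_succ_left (lo := p.a + 1) (hi := p.g - p.b + p.a) (by omega), show p.a + 1 + 1 = p.a + 2 by ring,
    eblock_succ_left (lo := p.a - p.b + 1) (hi := p.f) (by omega),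
    eblock_succ_left (lo := p.a - p.b + 1 + 1) (hi := p.f) (by omega),
    show p.a - p.b + 1 + 1 + 1 = p.a - p.b + 3 by ring, show p.a - p.b + 1 + 1 = p.a - p.b + 2 by ring,
    show p.e + p.f = (p.e + p.f - 1) + 1 by ring, eblock_succ_right (lo := p.e) (hi := p.e + p.f - 1) (by omega),
    show p.e + p.f - 1 + 1 - 1 = p.e + p.f - 1 by ring,
    show p.g = (p.g - 1) + 1 by ring, eblock_succ_right (lo := p.a) (hi := p.g - 1) (by omega)]
  simp only [show p.g - 1 + 1 = p.g by ring]
  simp only [Polynomial.eval_mul, Polynomial.eval_C, eval_lin]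
  have nz : ∀ K : ℤ, 1 ≤ K → K ≤ 4 * p.g → u + K ≠ 0 := fun K h1 h2 => hu K (mem_Icc.2 ⟨h1, h2⟩)
  have hDe : (eblock p.e (p.e + p.f - 1)).eval u ≠ 0 := by
    rw [eval_eblock]; exact prod_ne_zero_iff.2 fun i hi heq => nz (2 * i) (by rw [mem_Ico] at hi; omega)
      (by rw [mem_Ico] at hi; omega) (by push_cast; exact heq)
  have hDa : (eblock p.a (p.g - 1)).eval u ≠ 0 := by
    rw [eval_eblock]; exact prod_ne_zero_iff.2 fun i hi heq => nz (2 * i) (by rw [mem_Ico] at hi; omega)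
      (by rw [mem_Ico] at hi; omega) (by push_cast; exact heq)
  have n1 := nz (2 * (p.e + p.f - 1)) (by omega) (by omega)
  have n2 := nz (2 * (p.g - 1)) (by omega) (by omega)
  have n3 := nz (p.a + 1) (by omega) (by omega)
  have n4 := nz (p.a + 2) (by omega) (by omega)
  have n5 := nz (p.a + 3) (by omega) (by omega)
  have n6 := nz' (2 * (p.a - p.b + 1)) (by omega) (by omega)
  have n7 := nz' (2 * (p.a - p.b + 2)) (by omega) (by omega)
  have n8 := nz' (2 * (p.a - p.b + 3)) (by omega) (by omega)
  push_cast at n1 n2 n3 n4 n5 n6 n7 n8 ⊢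
  rw [show u / 2 + ((p.a : ℚ) - p.b + 1) = (u + 2 * ((p.a : ℚ) - p.b + 1)) / 2 by ring,
    show u / 2 + ((p.a : ℚ) - p.b + 2) = (u + 2 * ((p.a : ℚ) - p.b + 2)) / 2 by ring,
    show u / 2 + ((p.a : ℚ) - p.b + 3) = (u + 2 * ((p.a : ℚ) - p.b + 3)) / 2 by ring]
  have n3' : u + (p.a : ℚ) + 1 ≠ 0 := fun h => n3 (by linarith)
  have n4' : u + (p.a : ℚ) + 2 ≠ 0 := fun h => n4 (by linarith)
  have n5' : u + (p.a : ℚ) + 3 ≠ 0 := fun h => n5 (by linarith)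
  field_simp
  ring

/-! ### Step (2): the function identity -/

set_option maxHeartbeats 1600000 in
/-- **Function identity** `Σ_k c^a_k(p) F_R(p+kδ_a;u) = G(u+2) − G(u)` off the exceptional set `SeR = [−4g, 6g]` (StepER's). -/
theorem funId_aR (h0 : p.Omega) (h1 : (p.addA 1).Omega) (h2 : (p.addA 2).Omega) (h3 : (p.addA 3).Omega) {u : ℚ}
    (hu : ∀ K ∈ p.SeR, u + K ≠ 0) :
    p.coefA 0 * p.vR.eval u + p.coefA 1 * (p.addA 1).vR.eval u + p.coefA 2 * (p.addA 2).vR.eval u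
      + p.coefA 3 * (p.addA 3).vR.eval u = p.GfAR.eval (u + 2) - p.GfAR.eval u := by
  have hp := h0.pos
  obtain ⟨b1, b2, b3, b4⟩ := base_ineq_addA p h3
  obtain ⟨ef1, ef2, ef3⟩ := ef_ne_zero h3
  obtain ⟨o1, o2, o3, o4, o5, o6, o7, o8, o9⟩ := id h0
  have nz : ∀ K : ℤ, -(4 * p.g) ≤ K → K ≤ 6 * p.g → u + K ≠ 0 := fun K hK1 hK2 => hu K (by unfold SeR; rw [mem_Icc]; omega)
  have hu4 : ∀ K ∈ Icc 1 (4 * p.g), u + K ≠ 0 := fun K hK => by rw [mem_Icc] at hK; exact nz K (by omega) (by omega)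
  have hu4' : ∀ K ∈ Icc 1 (4 * p.g), u + 2 + K ≠ 0 := fun K hK => by
    rw [mem_Icc] at hK; have := nz (K + 2) (by omega) (by omega); push_cast at this; rwa [add_assoc, add_comm (2:ℚ)]
  have huR : ∀ K ∈ p.AR ∪ p.BR, u + K ≠ 0 := fun K hK => hu4 K (mem_Icc.2 (mem_Icc_of_mem h0 (Or.inr hK)))
  have huR2 : ∀ K ∈ p.AR ∪ p.BR, u + 2 + K ≠ 0 := fun K hK => hu4' K (mem_Icc.2 (mem_Icc_of_mem h0 (Or.inr hK)))
  -- the four values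
  set F0 := p.vR.eval u with hF0
  set F0' := p.vR.eval (u + 2) with hF0'
  have r1 := vR_ratio_addA h0 1 h1 hu4
  have r2 := vR_ratio_addA h0 2 h2 hu4
  have r3 := vR_ratio_addA h0 3 h3 hu4
  have ea := eval_block_123 (p.a + 1) u
  have eb := eval_block_123 (p.a - p.b + 1) (u / 2)
  have eg := eval_block_123 (p.g - p.b + p.a) u
  have ed := eval_block_123 p.a (u / 2)
  push_cast at r1 r2 r3 ea eb eg ed
  rw [ea.1, eb.1, eg.1, ed.1] at r1
  rw [ea.2.1, eb.2.1, eg.2.1, ed.2.1] at r2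
  rw [ea.2.2, eb.2.2, eg.2.2, ed.2.2] at r3
  simp only [prod_range_succ, prod_range_zero] at r1 r2 r3
  push_cast at r1 r2 r3
  -- the shift and the values of G
  have hS := vR_shift h0 huR huR2
  rw [← hF0, ← hF0'] at hS
  push_cast at hS
  have hs0 : ∀ K ∈ Icc (-(4 * p.g)) (4 * p.g), u + K ≠ 0 := fun K hK => by
    rw [mem_Icc] at hK; exact nz K (by omega) (by omega)
  have hs2 : ∀ K ∈ Icc (-(4 * p.g)) (4 * p.g), u + 2 + K ≠ 0 := fun K hK => by
    rw [mem_Icc] at hK; have := nz (K + 2) (by omega) (by omega); push_cast at this; rwa [add_assoc, add_comm (2:ℚ)]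
  have eG0 := GfAR_eq_cert h0 h3 hs0
  have eG2 := GfAR_eq_cert h0 h3 (u := u + 2) hs2
  rw [← hF0] at eG0
  rw [← hF0'] at eG2
  -- cert-2's cleared identity at t = u/2, atoms kept opaque; the cubic x_R as the polynomial `xPolyARu`
  have ex0 := eval_xPolyARu 0 (p.a : ℚ) p.b p.e p.f p.g u
  have ex1 := eval_xPolyARu 1 (p.a : ℚ) p.b p.e p.f p.g u
  push_cast at ex0 ex1
  rw [mul_zero, add_zero] at ex0
  rw [mul_one] at ex1
  have hc := telescope_a_R (p.a : ℚ) p.b p.e p.f p.g (u / 2)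
  simp only [numAR0, denAR0, lprod_nil, mul_one, one_mul] at hc
  rw [← ex0, ← ex1] at hc
  have c0 : p.coefA 0 = spvalC Certificates.TwoTaleTelescope.cA0 (p.a : ℚ) p.b p.e p.f p.g := rfl
  have c1 : p.coefA 1 = spvalC Certificates.TwoTaleTelescope.cA1 (p.a : ℚ) p.b p.e p.f p.g := rfl
  have c2 : p.coefA 2 = spvalC Certificates.TwoTaleTelescope.cA2 (p.a : ℚ) p.b p.e p.f p.g := rfl
  have c3 : p.coefA 3 = spvalC Certificates.TwoTaleTelescope.cA3 (p.a : ℚ) p.b p.e p.f p.g := rfl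
  -- non-vanishing of the cleared denominators
  have ha1 := nz (p.a + 1) (by omega) (by omega)
  have ha2 := nz (p.a + 2) (by omega) (by omega)
  have ha3 := nz (p.a + 3) (by omega) (by omega)
  have ha4 := nz (p.a + 4) (by omega) (by omega)
  have ha5 := nz (p.a + 5) (by omega) (by omega)
  have hb1 := nz (2 * (p.a - p.b + 1)) (by omega) (by omega)
  have hb2 := nz (2 * (p.a - p.b + 2)) (by omega) (by omega)
  have hb3 := nz (2 * (p.a - p.b + 3)) (by omega) (by omega)
  have hb4 := nz (2 * (p.a - p.b + 4)) (by omega) (by omega)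
  have hef := nz (2 * (p.e + p.f)) (by omega) (by omega)
  have hg := nz (2 * p.g) (by omega) (by omega)
  push_cast at ha1 ha2 ha3 ha4 ha5 hb1 hb2 hb3 hb4 hef hg
  have key := telescope_assembly (F0 := F0) (F0' := F0')
    (F1 := (p.addA 1).vR.eval u) (F2 := (p.addA 2).vR.eval u) (F3 := (p.addA 3).vR.eval u)
    (c0 := p.coefA 0) (c1 := p.coefA 1) (c2 := p.coefA 2) (c3 := p.coefA 3)
    (s1 := -1) (s2 := 1) (s3 := -1)
    (n1 := lprod numAR1 (p.a : ℚ) p.b p.e p.f p.g (u / 2)) (n2 := lprod numAR2 (p.a : ℚ) p.b p.e p.f p.g (u / 2))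
    (n3 := lprod numAR3 (p.a : ℚ) p.b p.e p.f p.g (u / 2))
    (d1 := lprod denAR1 (p.a : ℚ) p.b p.e p.f p.g (u / 2)) (d2 := lprod denAR2 (p.a : ℚ) p.b p.e p.f p.g (u / 2))
    (d3 := lprod denAR3 (p.a : ℚ) p.b p.e p.f p.g (u / 2))
    (tn := lprod tnAR (p.a : ℚ) p.b p.e p.f p.g (u / 2)) (td := lprod tdAR (p.a : ℚ) p.b p.e p.f p.g (u / 2))
    (cnum := lprod cnumAR (p.a : ℚ) p.b p.e p.f p.g (u / 2)) (cnumS := lprod cnumSAR (p.a : ℚ) p.b p.e p.f p.g (u / 2))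
    (cden := lprod cdenAR (p.a : ℚ) p.b p.e p.f p.g (u / 2)) (cdenS := lprod cdenSAR (p.a : ℚ) p.b p.e p.f p.g (u / 2))
    (x0 := (xPolyARu (p.a : ℚ) p.b p.e p.f p.g).eval u) (x1 := (xPolyARu (p.a : ℚ) p.b p.e p.f p.g).eval (u + 2))
    (by rw [denAR1_eval, numAR1_eval]; linear_combination r1)
    (by rw [denAR2_eval, numAR2_eval]; linear_combination r2)
    (by rw [denAR3_eval, numAR3_eval]; linear_combination r3)
    (by rw [tdAR_eval, tnAR_eval]; linear_combination hS)
    (by rw [denAR1_eval]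
        exact mul_ne_zero (mul_ne_zero (fun h => ef1 (by linarith)) (fun h => ha1 (by linarith))) (fun h => hb1 (by linarith)))
    (by rw [denAR2_eval]
        exact mul_ne_zero (mul_ne_zero (mul_ne_zero (mul_ne_zero (mul_ne_zero (fun h => ef1 (by linarith))
          (fun h => ef2 (by linarith))) (fun h => ha1 (by linarith))) (fun h => ha2 (by linarith))) (fun h => hb1 (by linarith)))
          (fun h => hb2 (by linarith)))
    (by rw [denAR3_eval]
        exact mul_ne_zero (mul_ne_zero (mul_ne_zero (mul_ne_zero (mul_ne_zero (mul_ne_zero (mul_ne_zero (mul_ne_zero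
          (fun h => ef1 (by linarith)) (fun h => ef2 (by linarith))) (fun h => ef3 (by linarith))) (fun h => ha1 (by linarith)))
          (fun h => ha2 (by linarith))) (fun h => ha3 (by linarith))) (fun h => hb1 (by linarith))) (fun h => hb2 (by linarith)))
          (fun h => hb3 (by linarith)))
    (by rw [tdAR_eval]
        exact mul_ne_zero (mul_ne_zero (mul_ne_zero (mul_ne_zero (fun h => ha1 (by linarith)) (fun h => ha2 (by linarith)))
          (fun h => hb1 (by linarith))) (fun h => hef (by linarith))) (fun h => hg (by linarith)))
    (by rw [cdenAR_eval]
        exact mul_ne_zero (mul_ne_zero (mul_ne_zero (mul_ne_zero (mul_ne_zero (mul_ne_zero (mul_ne_zero (mul_ne_zero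
          (fun h => ha1 (by linarith)) (fun h => hb1 (by linarith))) (fun h => ef1 (by linarith))) (fun h => ha2 (by linarith)))
          (fun h => hb2 (by linarith))) (fun h => ef2 (by linarith))) (fun h => ha3 (by linarith))) (fun h => hb3 (by linarith)))
          (fun h => ef3 (by linarith)))
    (by rw [cdenSAR_eval]
        exact mul_ne_zero (mul_ne_zero (mul_ne_zero (mul_ne_zero (mul_ne_zero (mul_ne_zero (mul_ne_zero (mul_ne_zero
          (fun h => ha3 (by linarith)) (fun h => hb2 (by linarith))) (fun h => ef1 (by linarith))) (fun h => ha4 (by linarith)))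
          (fun h => hb3 (by linarith))) (fun h => ef2 (by linarith))) (fun h => ha5 (by linarith))) (fun h => hb4 (by linarith)))
          (fun h => ef3 (by linarith)))
    (by rw [c0, c1, c2, c3]; linear_combination hc)
  rw [eG2, eG0, key, cnumSAR_eval, cnumAR_eval, cdenSAR_eval, cdenAR_eval]
  unfold certAR
  push_cast
  ring

/-! ### Step (3): the DATA identity -/

/-- **Data identity** `Σ_k c^a_k(p)·vR(p+kδ_a) = S²G − G` (Lemma U over `SeR`). -/
theorem dataId_aR (h0 : p.Omega) (h1 : (p.addA 1).Omega) (h2 : (p.addA 2).Omega) (h3 : (p.addA 3).Omega) :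
    PF.comb4 p.coefA ![p.vR, (p.addA 1).vR, (p.addA 2).vR, (p.addA 3).vR]
      = p.GfAR.shift.shift.add (p.GfAR.smul (-1)) := by
  have hp := h0.pos
  have hIcc : ∀ q : Pt, q.Omega → q.g = p.g → q.vR.poles ⊆ p.SeR := fun q hq hqg K hK => by
    have := mem_Icc.1 (poles_vR_Icc hq hK); unfold SeR; rw [mem_Icc]; omega
  refine PF.eq_of_eval_eq_on _ _ p.SeR ?_ ?_ fun u hu => ?_
  · refine (PF.poles_comb4_subset _ _).trans (union_subset (union_subset ?_ ?_) (union_subset ?_ ?_)) <;>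
      simp only [Matrix.cons_val_zero, Matrix.cons_val_one, Matrix.cons_val_two, Matrix.cons_val_three,
        Matrix.head_cons, Matrix.tail_cons]
    · exact hIcc p h0 rfl
    · exact hIcc _ h1 rfl
    · exact hIcc _ h2 rfl
    · exact hIcc _ h3 rfl
  · have hG : p.GfAR.poles ⊆ Icc 1 (4 * p.g) := fun K hK =>
      mem_Icc.2 (mem_Icc_of_mem h0 (Or.inl (PF.poles_ofFrac _ _ _ hK)))
    refine (PF.poles_shift2_sub_subset _).trans (union_subset ?_ (hG.trans fun K hK => ?_))
    · intro K hK
      obtain ⟨j, hj, rfl⟩ := mem_image.1 hK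
      obtain ⟨i, hi, rfl⟩ := mem_image.1 hj
      have := mem_Icc.1 (hG hi); unfold SeR; rw [mem_Icc]; omega
    · have := mem_Icc.1 hK; unfold SeR; rw [mem_Icc]; omega
  · rw [PF.eval_comb4, PF.eval_shift2_sub, Fin.sum_univ_four]
    simp only [Matrix.cons_val_zero, Matrix.cons_val_one, Matrix.cons_val_two, Matrix.cons_val_three,
      Matrix.head_cons, Matrix.tail_cons]
    exact funId_aR h0 h1 h2 h3 hu

/-! ### Step (4): legitimacy at the common node `M* = −(a+3)` (needs `g ≥ b+4`) -/

/-- At `u = −(a+3)` and `u = −(a+2)` the telescoped function has simple zeros (from `block(a+2,g−b+a)`, using `g ≥ b+4`) and no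
pole: all four formal residues vanish. -/
theorem GfAR_altRes (h : p.Omega) (h3 : (p.addA 3).Omega) (hgb : p.b + 4 ≤ p.g) :
    altRes0 (-(p.a + 3)) p.GfAR = 0 ∧ altRes0 (-(p.a + 3) + 1) p.GfAR = 0 ∧ altRes1 (-(p.a + 3)) p.GfAR = 0 ∧
      altRes1 (-(p.a + 3) + 1) p.GfAR = 0 := by
  obtain ⟨b1, b2, b3, b4⟩ := base_ineq_addA p h3
  obtain ⟨o1, o2, o3, o4, o5, o6, o7, o8, o9⟩ := h
  have hm : ∀ k ∈ p.AG ∪ p.BG, twoRange p.AG p.BG k = 1 ∨ twoRange p.AG p.BG k = 2 := fun _ hk => twoRange_mem hk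
  have hnot : ∀ K : ℤ, K ≤ p.a + 3 → K ∉ p.AG ∪ p.BG := fun K hK hmem => by
    rcases mem_union.1 hmem with h | h
    · obtain ⟨i, h1, h2, h3⟩ := mem_AG.1 h; omega
    · obtain ⟨i, h1, h2, h3⟩ := mem_BG.1 h; omega
  have hdvd : ∀ K : ℤ, p.a + 2 ≤ K → K < p.g - p.b + p.a → lin K ∣ p.NGAR := fun K h1 h2 => by
    unfold NGAR; exact (((lin_dvd_block h1 h2).mul_right _).mul_left _).mul_right _
  have e1 : -(-(p.a + 3)) = p.a + 3 := by ring
  have e2 : -(-(p.a + 3) + 1) = p.a + 2 := by ring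
  unfold GfAR
  refine ⟨?_, ?_, ?_, ?_⟩
  · rw [altRes0_eq_eval]
    refine mul_eq_zero_of_right _ ?_
    exact PF.eval_ofFrac_eq_zero_of_dvd _ _ p.NGAR hm (M := -(p.a + 3)) (by rw [e1]; exact hnot _ le_rfl)
      (by rw [e1]; exact hdvd _ (by omega) (by omega))
  · rw [altRes0_eq_eval]
    refine mul_eq_zero_of_right _ ?_
    exact PF.eval_ofFrac_eq_zero_of_dvd _ _ p.NGAR hm (M := -(p.a + 3) + 1) (by rw [e2]; exact hnot _ (by omega))
      (by rw [e2]; exact hdvd _ (by omega) (by omega))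
  · exact altRes1_ofFrac_eq_zero _ _ _ (by rw [e1]; exact hnot _ le_rfl)
  · exact altRes1_ofFrac_eq_zero _ _ _ (by rw [e2]; exact hnot _ (by omega))

/-- Along `δ_a` (`0 ≤ k ≤ 3`, `g ≥ b+4`): the own second-tale node of `p+kδ` lies left of `−(a+3)` and the move is inside its
window. -/
theorem altE_nodes_aR (h3 : (p.addA 3).Omega) (hgb : p.b + 4 ≤ p.g) {k : ℤ} (hk : (p.addA k).Omega)
    (hk0 : 0 ≤ k) (hk3 : k ≤ 3) (d : ℕ) :
    altE0 d (p.addA k).nodeR (p.addA k).vR = altE0 d (-(p.a + 3)) (p.addA k).vR ∧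
      altE1 (p.addA k).nodeR (p.addA k).vR = altE1 (-(p.a + 3)) (p.addA k).vR := by
  obtain ⟨b1, b2, b3, b4⟩ := base_ineq_addA p h3
  have hn : (p.addA k).nodeR = 1 - a0star (p.addA k).t2a := rfl
  have ha0 := a0star_t2a_eq hk
  simp only [addA_a, addA_b, addA_e, addA_f, addA_g] at ha0
  refine altE_nodeR_to hk _ d ?_ ?_
  · rw [hn, ha0]
    rcases le_total p.e p.f with hef | hef
    · rw [max_eq_right hef]; omega
    · rw [max_eq_left hef]; omega
  · rw [addA_a]; omega

/-! ### Step (6): the second-tale recurrence of direction `a` -/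

/-- **Direction `a`, second tale (for `g ≥ b + 4`).** For `p, p+δ, p+2δ, p+3δ ∈ Ω` (`δ = δ_a`) with `g ≥ b+4`, the second-tale
functionals at their own nodes satisfy cert-2's telescoper (truncation `0`). -/
theorem recR_a (h0 : p.Omega) (h1 : (p.addA 1).Omega) (h2 : (p.addA 2).Omega) (h3 : (p.addA 3).Omega)
    (hgb : p.b + 4 ≤ p.g) :
    (p.coefA 0 * altE1 p.nodeR p.vR + p.coefA 1 * altE1 (p.addA 1).nodeR (p.addA 1).vR
      + p.coefA 2 * altE1 (p.addA 2).nodeR (p.addA 2).vR + p.coefA 3 * altE1 (p.addA 3).nodeR (p.addA 3).vR = 0) ∧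
    (p.coefA 0 * altE0 0 p.nodeR p.vR + p.coefA 1 * altE0 0 (p.addA 1).nodeR (p.addA 1).vR
      + p.coefA 2 * altE0 0 (p.addA 2).nodeR (p.addA 2).vR + p.coefA 3 * altE0 0 (p.addA 3).nodeR (p.addA 3).vR = 0) := by
  have hdata := dataId_aR h0 h1 h2 h3
  have hres := GfAR_altRes h0 h3 hgb
  have h0' : (p.addA 0).Omega := by
    have : p.addA 0 = p := by cases p; simp [addA]
    rw [this]; exact h0
  have m0 := altE_nodes_aR h3 hgb h0' le_rfl (by norm_num) 0
  have e00 : p.addA 0 = p := by cases p; simp [addA]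
  rw [e00] at m0
  have m1 := altE_nodes_aR h3 hgb h1 (by norm_num) (by norm_num) 0
  have m2 := altE_nodes_aR h3 hgb h2 (by norm_num) (by norm_num) 0
  have m3 := altE_nodes_aR h3 hgb h3 (by norm_num) (by norm_num) 0
  have s1 := altE1_step2 (-(p.a + 3)) p.coefA _ p.GfAR hdata
  have s0 := altE0_step2 0 (-(p.a + 3)) p.coefA _ p.GfAR hdata (natDegree_GfAR_le h0 h3)
  rw [Fin.sum_univ_four] at s1 s0
  simp only [Matrix.cons_val_zero, Matrix.cons_val_one, Matrix.cons_val_two, Matrix.cons_val_three,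
    Matrix.head_cons, Matrix.tail_cons] at s1 s0
  rw [hres.2.2.1, hres.2.2.2] at s1
  rw [hres.1, hres.2.1] at s0
  rw [m0.2, m1.2, m2.2, m3.2, m0.1, m1.1, m2.1, m3.1]
  constructor
  · linarith
  · linarith

end Pt

end Summit.KontsevichZagierPeriods.Zeta5Search.TwoTaleOmega

end
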